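import Mathlib.RingTheory.MvPolynomial.WeightedHomogeneous
import Mathlib.RingTheory.FiniteType
import Mathlib.RingTheory.RegularLocalRing.Polynomial
import Mathlib.RingTheory.Spectrum.Prime.Basic
import Mathlib.Algebra.Order.Antidiag.Finsupp
import Literature.AlgebraicGeometry.Resolution.AffineBlowupAlgebra
import Literature.AlgebraicGeometry.Resolution.AffineBlowup
import HarnessLib

/-!
# The vertex of the Veronese cone `V(n,r)` is a single point

Support file for crux stmt-ResolutionOfSingularities-15317 (`FrobeniusLadder.FRationalResolution`), line `redirect`,
lead c5, CONE PROGRAMME (rung 4′ in all dimensions on the Veronese cones `V(n,r) = Spec k[χᵈ : |d| = r]`).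
Stub `stub_veronese_point_eq`: for the `r`-th Veronese subring `VR(n,r) = k[χᵈ : |d| = r] ⊆ k[x₁,…,xₙ]`,
two primes of `VR(n,r)` containing every degree-`r` monomial coincide — both are the set of elements with
vanishing constant coefficient (the vertex, kernel of the constant coefficient `VR(n,r) → k`).

* `veroneseVertex_monomial_mem` — an ideal containing the degree-`r` monomials contains every monomial
  `χᵈ ∈ VR(n,r)` with `d ≠ 0`, `r ∣ |d|`: `|d| = r s`, `s ≥ 1`, and `χᵈ` is a product of `s` degree-`r`
  monomials (splitting hypothesis);
* `veroneseVertex_mem_span` — `VR(n,r)` lies in the `k`-span of the monomials `χᵈ`, `r ∣ |d|`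
  (membership criterion + `MvPolynomial.as_sum`);
* `veroneseVertex_sub_const_mem` — hence `t - t(0) ∈ P` for every `t ∈ VR(n,r)` (`t(0)` the constant
  coefficient), by `Submodule.span_induction`;
* `veroneseVertex_mem_iff` — so for a prime `P` through the vertex, `t ∈ P ↔ t(0) = 0`;
* `stub_veronese_point_eq` — two such primes coincide.

All folklore (the irrelevant/vertex maximal ideal of an affine cone; cf. Bruns–Herzog 1998 §6.1 for Veronese
subrings); only Mathlib's `MvPolynomial` / `Algebra.adjoin` / `Ideal` API is used; no named facts. Template:
the toric analogue `stub_toric_point_eq` (…ToricVertexUnique). [folklore]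
-/

-- single-problem summit: the doubled namespace component is forced
set_option linter.dupNamespace false

noncomputable section

namespace Summit.ResolutionOfSingularities.ResolutionOfSingularities.Theorems.FRationalResolution

open MvPolynomial
open Literature.AlgebraicGeometry.Resolution

section Cones

variable (k : Type) [Field k]

/-- The polynomial ring in `n` variables. -/
local notation3 "MP[" n "]" => MvPolynomial (Fin n) k

/-- The `r`-th Veronese subring of `k[x₁,…,xₙ]`: the `k`-subalgebra generated by the degree-`r` monomials. -/
local notation3 "VR[" n ", " r "]" =>
  Algebra.adjoin k ((fun d : Fin n →₀ ℕ => MvPolynomial.monomial d (1 : k)) ''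
    {d : Fin n →₀ ℕ | Finsupp.degree d = (r : ℕ)})

/-- **Non-constant Veronese monomials lie in every ideal through the vertex.** If an ideal `P` of
`VR[n,r]` contains every degree-`r` monomial, then it contains every monomial `χᵈ ∈ VR[n,r]` with
`d ≠ 0` and `r ∣ |d|`: writing `|d| = r·s`, the splitting hypothesis gives `d = ∑ⱼ eⱼ` with `|eⱼ| = r`
(`j < s`), so `χᵈ = ∏ⱼ χ^{eⱼ}` inside `VR[n,r]` (`MvPolynomial.monomial_sum_one`); as `d ≠ 0` forces
`s ≥ 1`, the factor `χ^{e₀} ∈ P` puts the product in `P`. [folklore] -/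
theorem veroneseVertex_monomial_mem (n r : ℕ)
    (hsplit : ∀ (s : ℕ) (d : Fin n →₀ ℕ), Finsupp.degree d = r * s →
      ∃ e : Fin s → (Fin n →₀ ℕ), (∀ j, Finsupp.degree (e j) = r) ∧ d = ∑ j, e j)
    (P : Ideal ↥VR[n, r])
    (hP : ∀ v : ↥VR[n, r], (∃ d : Fin n →₀ ℕ, Finsupp.degree d = r ∧
      (v : MP[n]) = MvPolynomial.monomial d 1) → v ∈ P)
    (d : Fin n →₀ ℕ) (hd0 : d ≠ 0) (hd : r ∣ Finsupp.degree d)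
    (h : MvPolynomial.monomial d (1 : k) ∈ VR[n, r]) :
    (⟨MvPolynomial.monomial d 1, h⟩ : ↥VR[n, r]) ∈ P := by
  obtain ⟨s, hs⟩ := hd
  obtain ⟨e, he, hde⟩ := hsplit s d hs
  -- `s ≥ 1`, for otherwise `d = ∑_{j < 0} eⱼ = 0`
  have hs0 : 0 < s := by
    refine Nat.pos_of_ne_zero ?_
    rintro rfl
    exact hd0 (by simpa using hde)
  have hej : ∀ j, MvPolynomial.monomial (e j) (1 : k) ∈ VR[n, r] := fun j =>
    Algebra.subset_adjoin ⟨e j, he j, rfl⟩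
  -- `χᵈ = ∏ⱼ χ^{eⱼ}` in `VR[n,r]`
  have hprod : (⟨MvPolynomial.monomial d 1, h⟩ : ↥VR[n, r]) =
      ∏ j, ⟨MvPolynomial.monomial (e j) 1, hej j⟩ := by
    apply Subtype.ext
    rw [SubmonoidClass.coe_finsetProd]
    change MvPolynomial.monomial d (1 : k) = ∏ j, MvPolynomial.monomial (e j) (1 : k)
    rw [hde, MvPolynomial.monomial_sum_one]
  rw [hprod, ← Finset.mul_prod_erase Finset.univ _ (Finset.mem_univ (⟨0, hs0⟩ : Fin s))]
  exact Ideal.mul_mem_right _ _ (hP _ ⟨e ⟨0, hs0⟩, he _, rfl⟩)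

/-- **`VR[n,r]` is spanned by its monomials.** Given the membership criterion (`f ∈ VR[n,r]` iff all
monomials of `supp f` have degree divisible by `r`), every `f ∈ VR[n,r]` lies in the `k`-span of the
monomials `χᵈ` with `r ∣ |d|`: `f = ∑_{d ∈ supp f} (coeff d f) • χᵈ` (`MvPolynomial.as_sum`). [folklore] -/
theorem veroneseVertex_mem_span (n r : ℕ)
    (hmem : ∀ f : MP[n], f ∈ VR[n, r] ↔ ∀ d ∈ f.support, r ∣ Finsupp.degree d)
    (f : MP[n]) (hf : f ∈ VR[n, r]) :
    f ∈ Submodule.span k ((fun d : Fin n →₀ ℕ => MvPolynomial.monomial d (1 : k)) ''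
      {d : Fin n →₀ ℕ | r ∣ Finsupp.degree d}) := by
  have hf' := (hmem f).mp hf
  rw [f.as_sum]
  refine Submodule.sum_mem _ (fun d hd => ?_)
  have hsm : MvPolynomial.monomial d (coeff d f) = coeff d f • MvPolynomial.monomial d (1 : k) := by
    rw [MvPolynomial.smul_monomial, smul_eq_mul, mul_one]
  rw [hsm]
  exact Submodule.smul_mem _ _ (Submodule.subset_span ⟨d, hf' d hd, rfl⟩)

/-- The monomials `χᵈ` with `r ∣ |d|` lie in `VR[n,r]` (membership criterion: `supp χᵈ ⊆ {d}`), hence so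
does their `k`-span. [folklore] -/
theorem veroneseVertex_span_le (n r : ℕ)
    (hmem : ∀ f : MP[n], f ∈ VR[n, r] ↔ ∀ d ∈ f.support, r ∣ Finsupp.degree d) :
    Submodule.span k ((fun d : Fin n →₀ ℕ => MvPolynomial.monomial d (1 : k)) ''
      {d : Fin n →₀ ℕ | r ∣ Finsupp.degree d}) ≤ Subalgebra.toSubmodule VR[n, r] := by
  rw [Submodule.span_le]
  rintro _ ⟨d, hd, rfl⟩
  rw [SetLike.mem_coe, Subalgebra.mem_toSubmodule]
  refine (hmem _).mpr (fun d' hd' => ?_)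
  rw [Finset.mem_singleton.mp (support_monomial_subset hd')]
  exact hd

/-- **Every element of `VR[n,r]` is its constant term modulo an ideal through the vertex.** If the ideal
`P` of `VR[n,r]` contains every degree-`r` monomial, then `t - t(0) ∈ P` for every `t ∈ VR[n,r]`, where
`t(0)` is the constant coefficient: `t` is a `k`-combination of monomials `χᵈ`, `r ∣ |d|`
(`veroneseVertex_mem_span`), the non-constant ones lie in `P` (`veroneseVertex_monomial_mem`) and
`χ⁰ = 1` is its own constant term (`Submodule.span_induction`). [folklore] -/
theorem veroneseVertex_sub_const_mem (n r : ℕ)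
    (hsplit : ∀ (s : ℕ) (d : Fin n →₀ ℕ), Finsupp.degree d = r * s →
      ∃ e : Fin s → (Fin n →₀ ℕ), (∀ j, Finsupp.degree (e j) = r) ∧ d = ∑ j, e j)
    (hmem : ∀ f : MP[n], f ∈ VR[n, r] ↔ ∀ d ∈ f.support, r ∣ Finsupp.degree d)
    (P : Ideal ↥VR[n, r])
    (hP : ∀ v : ↥VR[n, r], (∃ d : Fin n →₀ ℕ, Finsupp.degree d = r ∧
      (v : MP[n]) = MvPolynomial.monomial d 1) → v ∈ P)
    (t : ↥VR[n, r]) :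
    t - algebraMap k ↥VR[n, r] (MvPolynomial.constantCoeff (t : MP[n])) ∈ P := by
  classical
  obtain ⟨t, ht⟩ := t
  have hts := veroneseVertex_mem_span k n r hmem t ht
  have hle := veroneseVertex_span_le k n r hmem
  refine Submodule.span_induction
    (p := fun u _ => ∀ hu : u ∈ VR[n, r],
      (⟨u, hu⟩ : ↥VR[n, r]) - algebraMap k ↥VR[n, r] (MvPolynomial.constantCoeff u) ∈ P)
    ?_ ?_ ?_ ?_ hts ht
  · -- monomials `χᵈ`, `r ∣ |d|`
    rintro _ ⟨d, hd, rfl⟩ hu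
    dsimp only
    by_cases hd0 : d = 0
    · subst hd0
      have h1 : (⟨MvPolynomial.monomial (0 : Fin n →₀ ℕ) (1 : k), hu⟩ : ↥VR[n, r]) = 1 :=
        Subtype.ext (by
          change MvPolynomial.monomial (0 : Fin n →₀ ℕ) (1 : k) = ((1 : ↥VR[n, r]) : MP[n])
          rw [OneMemClass.coe_one, MvPolynomial.monomial_zero', C_1])
      rw [h1, MvPolynomial.constantCoeff_monomial, if_pos rfl, map_one, sub_self]
      exact P.zero_mem
    · rw [MvPolynomial.constantCoeff_monomial, if_neg hd0, map_zero, sub_zero]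
      exact veroneseVertex_monomial_mem k n r hsplit P hP d hd0 hd hu
  · -- zero
    intro hu
    have h0 : (⟨0, hu⟩ : ↥VR[n, r]) = 0 := Subtype.ext rfl
    rw [h0, map_zero, map_zero, sub_zero]
    exact P.zero_mem
  · -- sums
    intro u v hu' hv' ihu ihv huv
    have hu : u ∈ VR[n, r] := hle hu'
    have hv : v ∈ VR[n, r] := hle hv'
    have he : (⟨u + v, huv⟩ : ↥VR[n, r]) = ⟨u, hu⟩ + ⟨v, hv⟩ := rfl
    rw [he, map_add, map_add, add_sub_add_comm]
    exact P.add_mem (ihu hu) (ihv hv)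
  · -- scalar multiples
    intro c u hu' ihu hcu
    have hu : u ∈ VR[n, r] := hle hu'
    have he : (⟨c • u, hcu⟩ : ↥VR[n, r]) = c • ⟨u, hu⟩ := rfl
    rw [he, MvPolynomial.constantCoeff_smul, smul_eq_mul, map_mul, Algebra.smul_def, ← mul_sub]
    exact Ideal.mul_mem_left P _ (ihu hu)

/-- **Primes through the vertex are determined.** If a prime `P` of `VR[n,r]` contains every degree-`r`
monomial, then `t ∈ P ↔ t(0) = 0` (`t(0)` the constant coefficient). `⇐`: `veroneseVertex_sub_const_mem`;
`⇒`: otherwise the unit `t(0) = t - (t - t(0))` lies in `P`. [folklore] -/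
theorem veroneseVertex_mem_iff (n r : ℕ)
    (hsplit : ∀ (s : ℕ) (d : Fin n →₀ ℕ), Finsupp.degree d = r * s →
      ∃ e : Fin s → (Fin n →₀ ℕ), (∀ j, Finsupp.degree (e j) = r) ∧ d = ∑ j, e j)
    (hmem : ∀ f : MP[n], f ∈ VR[n, r] ↔ ∀ d ∈ f.support, r ∣ Finsupp.degree d)
    (P : Ideal ↥VR[n, r]) [hPr : P.IsPrime]
    (hP : ∀ v : ↥VR[n, r], (∃ d : Fin n →₀ ℕ, Finsupp.degree d = r ∧
      (v : MP[n]) = MvPolynomial.monomial d 1) → v ∈ P)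
    (t : ↥VR[n, r]) :
    t ∈ P ↔ MvPolynomial.constantCoeff (t : MP[n]) = 0 := by
  have h := veroneseVertex_sub_const_mem k n r hsplit hmem P hP t
  refine ⟨fun ht => ?_, fun hc => by rwa [hc, map_zero, sub_zero] at h⟩
  by_contra hc
  refine hPr.ne_top (Ideal.eq_top_of_isUnit_mem P ?_
    ((IsUnit.mk0 _ hc).map (algebraMap k ↥VR[n, r])))
  have h' := P.sub_mem ht h
  rwa [sub_sub_cancel] at h'

/-- **THE VERTEX OF `V(n,r)` IS A SINGLE POINT** (registered stub `stub_veronese_point_eq`, crux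
stmt-ResolutionOfSingularities-15317, line `redirect`). For `1 ≤ r`, two primes of the Veronese subring
`VR[n,r] = k[χᵈ : |d| = r]` containing every degree-`r` monomial coincide: each contains every monomial
`χᵈ` of positive degree `r·s` (a product of `s` degree-`r` monomials, splitting hypothesis `hsplit`), hence
every element with zero constant coefficient (membership criterion `hmem`: `VR[n,r]` is the `k`-span of its
monomials), and conversely consists of such elements since it is proper; so both are the kernel of the
constant coefficient `VR[n,r] → k` (`veroneseVertex_mem_iff`). The hypothesis `1 ≤ r` is not used.
[folklore; cf. Bruns–Herzog 1998 §6.1] -/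
theorem stub_veronese_point_eq (n r : ℕ) (hr : 1 ≤ r)
    (hsplit : ∀ (s : ℕ) (d : Fin n →₀ ℕ), Finsupp.degree d = r * s →
      ∃ e : Fin s → (Fin n →₀ ℕ), (∀ j, Finsupp.degree (e j) = r) ∧ d = ∑ j, e j)
    (hmem : ∀ f : MP[n], f ∈ VR[n, r] ↔ ∀ d ∈ f.support, r ∣ Finsupp.degree d)
    (P Q : PrimeSpectrum ↥VR[n, r])
    (hP : ∀ v : ↥VR[n, r], (∃ d : Fin n →₀ ℕ, Finsupp.degree d = r ∧
      (v : MP[n]) = MvPolynomial.monomial d 1) → v ∈ P.asIdeal)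
    (hQ : ∀ v : ↥VR[n, r], (∃ d : Fin n →₀ ℕ, Finsupp.degree d = r ∧
      (v : MP[n]) = MvPolynomial.monomial d 1) → v ∈ Q.asIdeal) : P = Q := by
  have _ := hr
  ext t
  rw [veroneseVertex_mem_iff k n r hsplit hmem P.asIdeal hP t,
    veroneseVertex_mem_iff k n r hsplit hmem Q.asIdeal hQ t]

end Cones

end Summit.ResolutionOfSingularities.ResolutionOfSingularities.Theorems.FRationalResolution

end
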